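import Literature.Probability.Percolation.CollarFaceWindows
import Literature.Probability.Percolation.CollarWindowDist
import Literature.Probability.Percolation.DyadicLevelSum
import HarnessLib

/-!
# The bad event of a wall face is small

Topic `Probability/Percolation`.  Support file (proofs, no named fact) for the named fact
`SchrammSmirnov2011_thm_1_7` (the landing count of the proof of Prop. 4.1, Ann. Probab. 39 (2011),
§4): for a wall face `[a, b]` in a frame `ψ` all of whose windows fitting inside are clean
(hypothesis `hclean`) and all far sites at distance `≥ S` from every face column (hypothesis `hfar`),
the bad event `badFace a b w₀ m` (a hub vertex within `w₀ = 10 K m` of an end, or a bad pattern at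
one of the windows of width `m` tiling the middle) has probability `≤ C (m/S)^ε`
(`real_badFace_le`).  The window at distance `t` from the nearer end is clean with radius `t - 2`
and costs `≤ A (m/t)^{1+α} · (5t/S)^ε` or `≤ A (m/t)^{1+α}` (`window_cost`, from
`real_patternAt_le_of_dist(_far)`); grouping the windows by the dyadic level of `t` — each level
holds `≤ B₀ 2^k` windows since the distances run through two arithmetic progressions of step
`m - 1` (`card_level_le`) — the sum is `DyadicLevel.sum_le_of_levels`; the two corner terms are
`real_cornerEvent_le`.

## References

* O. Schramm, S. Smirnov, *On the scaling limits of planar percolation*, Ann. Probab. 39 (2011)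
  1768–1814, arXiv:1101.5820, §4, proof of Prop. 4.1. [SchrammSmirnov2011]
-/

noncomputable section

open MeasureTheory Set Metric Finset
open Literature.Probability.LatticeModels

namespace Literature.Probability.Percolation

namespace Seeded

namespace CollarDatum

/-! ### The unified window cost -/

/-- **The cost of a clean window at distance `t = d + m + 3`** (unified exponents): `≤ A (m/t)^{1+α}`
always, and `≤ A (m/t)^{1+α} (5t/S)^ε` when the far sites are beyond `S ≥ 10 t`; here `0 < ε < α`.
[cite: SchrammSmirnov2011, §4, proof of Prop. 4.1] -/
theorem window_cost : ∃ A α ε : ℝ, ∃ K m₀ : ℕ, 0 < A ∧ 0 < ε ∧ ε < α ∧ 1 ≤ K ∧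
    ∀ (𝒞 : CollarDatum) (ψ : LatticeSym) (j : ℤ) (m d : ℕ) (S : ℝ), m₀ ≤ m → 8 * K * m ≤ d + m + 3 →
      (𝒞.map ψ).CleanWindow j m (d + m + 1) →
      ((bondPercolation (zdGraph 2) half).real (𝒞.patternOneAt ψ j m ∪ 𝒞.patternTwoAt ψ j m) ≤
          A * ((m : ℝ) / (d + m + 3 : ℕ)) ^ (1 + α)) ∧
      (10 * ((d + m + 3 : ℕ) : ℝ) ≤ S → (∀ u ∈ 𝒞.Far, S ≤ dist (meshPoint 1 (ψ.σ u)) (meshPoint 1 ![j, 0])) →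
        (bondPercolation (zdGraph 2) half).real (𝒞.patternOneAt ψ j m ∪ 𝒞.patternTwoAt ψ j m) ≤
          A * ((m : ℝ) / (d + m + 3 : ℕ)) ^ (1 + α) * (5 * ((d + m + 3 : ℕ) : ℝ) / S) ^ ε) := by
  obtain ⟨A₁, α₃, K₁, hA₁, hα₃, hK₁, h₁⟩ := real_patternAt_le_of_dist
  obtain ⟨A₂, α₃', α₁, K₂, m₀, hA₂, hα₃', hα₁, hK₂, h₂⟩ := real_patternAt_le_of_dist_far
  set α : ℝ := min α₃ α₃' with hα
  have hαpos : 0 < α := lt_min hα₃ hα₃'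
  set ε : ℝ := min α₁ (α / 2) with hε
  refine ⟨max A₁ A₂, α, ε, max K₁ K₂, max m₀ 4, by positivity, lt_min hα₁ (by positivity),
    lt_of_le_of_lt (min_le_right _ _) (by linarith), le_trans hK₁ (le_max_left _ _), fun 𝒞 ψ j m d S hm ht hW => ?_⟩
  have hm4 : 4 ≤ m := le_trans (le_max_right _ _) hm
  have hm₀ : m₀ ≤ m := le_trans (le_max_left _ _) hm
  have ht₁ : 8 * K₁ * m ≤ d + m + 3 := le_trans (by gcongr; exact le_max_left _ _) ht
  have ht₂ : 8 * K₂ * m ≤ d + m + 3 := le_trans (by gcongr; exact le_max_right _ _) ht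
  set t : ℕ := d + m + 3 with ht_def
  have hmt : (m : ℝ) / t ≤ 1 := by
    rw [div_le_one (by positivity)]; exact_mod_cast (show m ≤ t by omega)
  have hmt0 : 0 ≤ (m : ℝ) / t := by positivity
  -- comparing exponents on a base `≤ 1`
  have hpow : ∀ {β : ℝ}, α ≤ β → ((m : ℝ) / t) ^ (1 + β) ≤ ((m : ℝ) / t) ^ (1 + α) := fun hβ =>
    Real.rpow_le_rpow_of_exponent_ge' hmt0 hmt (by linarith) (by linarith)
  constructor
  · calc (bondPercolation (zdGraph 2) half).real (𝒞.patternOneAt ψ j m ∪ 𝒞.patternTwoAt ψ j m)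
        ≤ A₁ * ((m : ℝ) / t) ^ (1 + α₃) := h₁ 𝒞 ψ j m d hm4 ht₁ hW
      _ ≤ max A₁ A₂ * ((m : ℝ) / t) ^ (1 + α) :=
          mul_le_mul (le_max_left _ _) (hpow (min_le_left _ _)) (by positivity) (by positivity)
  · intro htS hFar
    have hS : 0 < S := by
      have : (0 : ℝ) < t := by positivity
      linarith
    have hb : 5 * (t : ℝ) / S ≤ 1 := by rw [div_le_one hS]; linarith
    have hb0 : 0 ≤ 5 * (t : ℝ) / S := by positivity
    calc (bondPercolation (zdGraph 2) half).real (𝒞.patternOneAt ψ j m ∪ 𝒞.patternTwoAt ψ j m)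
        ≤ A₂ * ((m : ℝ) / t) ^ (1 + α₃') * (5 * (t : ℝ) / S) ^ α₁ := h₂ 𝒞 ψ j m d S hm₀ ht₂ htS hW hFar
      _ ≤ max A₁ A₂ * ((m : ℝ) / t) ^ (1 + α) * (5 * (t : ℝ) / S) ^ ε := by
          refine mul_le_mul (mul_le_mul (le_max_right _ _) (hpow (min_le_right _ _)) (by positivity) (by positivity))
            (Real.rpow_le_rpow_of_exponent_ge' hb0 hb (by positivity) (min_le_left _ _)) (by positivity) (by positivity)

/-! ### The distances of the windows to the ends -/

/-- The distance of the `i`-th window to the left end: `faceJ i - a = w₀ - 1 + i (m-1)`. [folklore] -/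
def distL (w₀ m i : ℕ) : ℕ := w₀ - 1 + i * (m - 1)

/-- The distance of the `i`-th window to the right end: `b - faceJ i - m`. [folklore] -/
def distR (a b : ℤ) (w₀ m i : ℕ) : ℕ := (b - faceJ a w₀ m i - m).toNat

/-- The distance of the `i`-th window to the nearer end. [folklore] -/
def distW (a b : ℤ) (w₀ m i : ℕ) : ℕ := min (distL w₀ m i) (distR a b w₀ m i)

/-- The last window starts before the right corner region. [folklore] -/
theorem faceJ_add_one_le {a b : ℤ} {w₀ m : ℕ} (hm : 2 ≤ m) {i : ℕ} (hi : i < faceN a b w₀ m) :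
    faceJ a w₀ m i + 1 ≤ b - w₀ := by
  have hm1 : (0 : ℤ) < (m - 1 : ℤ) := by omega
  unfold faceN at hi
  set q : ℤ := (b - a - 2 * w₀ + 1 + (m - 2 : ℤ)) / (m - 1 : ℤ) with hq
  have hN : (i : ℤ) + 1 ≤ q := by
    have : (i : ℤ) < q.toNat := by exact_mod_cast hi
    have hq0 : 0 ≤ q := by
      by_contra h
      push Not at h
      rw [Int.toNat_of_nonpos h.le] at this
      omega
    rw [Int.toNat_of_nonneg hq0] at this
    omega
  have hqm : q * (m - 1 : ℤ) ≤ b - a - 2 * w₀ + 1 + (m - 2 : ℤ) := Int.ediv_mul_le _ hm1.ne'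
  rw [faceJ]
  nlinarith

/-- The distances in real terms, for `i < faceN`. [folklore] -/
theorem distW_spec {a b : ℤ} {w₀ m : ℕ} (hm : 2 ≤ m) (hw : m ≤ w₀) {i : ℕ} (hi : i < faceN a b w₀ m) :
    (distL w₀ m i : ℤ) = faceJ a w₀ m i - a ∧ (distR a b w₀ m i : ℤ) = b - faceJ a w₀ m i - m ∧
      w₀ + 1 - m ≤ (distW a b w₀ m i : ℤ) ∧
      (distW a b w₀ m i : ℤ) ≤ faceJ a w₀ m i - a ∧ (distW a b w₀ m i : ℤ) ≤ b - faceJ a w₀ m i - m := by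
  have h1 := faceJ_add_one_le hm hi
  have hL : (distL w₀ m i : ℤ) = faceJ a w₀ m i - a := by
    rw [distL, faceJ]; push_cast [Nat.cast_sub (by omega : 1 ≤ w₀), Nat.cast_sub (by omega : 1 ≤ m)]; ring
  have hR : (distR a b w₀ m i : ℤ) = b - faceJ a w₀ m i - m := by
    rw [distR, Int.toNat_of_nonneg (by omega)]
  refine ⟨hL, hR, ?_, ?_, ?_⟩
  · rw [distW, Nat.cast_min, hL, hR, le_min_iff]
    constructor
    · rw [faceJ]; have : (0 : ℤ) ≤ i * (m - 1 : ℤ) := mul_nonneg (by positivity) (by omega)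
      linarith
    · omega
  · rw [distW, Nat.cast_min, hL, hR]; exact min_le_left _ _
  · rw [distW, Nat.cast_min, hL, hR]; exact min_le_right _ _

/-- **The level count**: the windows whose distance lies in a real window `[u, u + len)` number at
most `2 (len/(m-1) + 2)` (two arithmetic progressions of step `m - 1`). [folklore] -/
theorem card_distW_window_le {a b : ℤ} {w₀ m : ℕ} (hm : 2 ≤ m) (hw : m ≤ w₀) {u len : ℝ} (hlen : 0 ≤ len) :
    (((Finset.range (faceN a b w₀ m)).filter fun i => u ≤ (distW a b w₀ m i : ℝ) ∧ (distW a b w₀ m i : ℝ) < u + len).card : ℝ) ≤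
      2 * (len / (m - 1 : ℝ) + 2) := by
  classical
  have hm1 : (0 : ℝ) < (m - 1 : ℝ) := by
    have : (2 : ℝ) ≤ m := by exact_mod_cast hm
    linarith
  set F := (Finset.range (faceN a b w₀ m)).filter fun i => u ≤ (distW a b w₀ m i : ℝ) ∧ (distW a b w₀ m i : ℝ) < u + len with hF
  -- split according to which end is nearer
  set FL := F.filter fun i => distW a b w₀ m i = distL w₀ m i with hFL
  set FR := F.filter fun i => distW a b w₀ m i = distR a b w₀ m i with hFR
  have hcover : F ⊆ FL ∪ FR := by
    intro i hi
    rw [Finset.mem_union]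
    rcases min_choice (distL w₀ m i) (distR a b w₀ m i) with h | h
    · exact Or.inl (by rw [hFL]; exact Finset.mem_filter.2 ⟨hi, h⟩)
    · exact Or.inr (by rw [hFR]; exact Finset.mem_filter.2 ⟨hi, h⟩)
  -- the left progression: `distL i = (w₀ - 1) + i (m-1)`
  have hLcard : FL.card ≤ ⌊len / (m - 1 : ℝ)⌋₊ + 1 := by
    refine DyadicLevel.card_le_of_mem_window (u := (u - (w₀ - 1 : ℝ)) / (m - 1 : ℝ)) (by positivity) fun i hi => ?_
    rw [hFL, Finset.mem_filter, hF, Finset.mem_filter] at hi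
    obtain ⟨⟨-, h1, h2⟩, h3⟩ := hi
    rw [h3] at h1 h2
    have hdL : (distL w₀ m i : ℝ) = (w₀ - 1 : ℝ) + i * (m - 1 : ℝ) := by
      rw [distL]; push_cast [Nat.cast_sub (by omega : 1 ≤ w₀), Nat.cast_sub (by omega : 1 ≤ m)]; ring
    rw [hdL] at h1 h2
    constructor
    · rw [div_le_iff₀ hm1]; linarith
    · rw [← add_div, lt_div_iff₀ hm1]; linarith
  -- the right progression: `distR i = R₀ - i (m-1)` with `R₀ = b - a - w₀ + 1 - m`
  have hRcard : FR.card ≤ ⌊len / (m - 1 : ℝ) + 1⌋₊ + 1 := by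
    set R₀ : ℝ := (b : ℝ) - a - w₀ + 1 - m with hR₀
    refine DyadicLevel.card_le_of_mem_window (u := (R₀ - u - len) / (m - 1 : ℝ)) (by positivity) fun i hi => ?_
    rw [hFR, Finset.mem_filter, hF, Finset.mem_filter, Finset.mem_range] at hi
    obtain ⟨⟨hiN, h1, h2⟩, h3⟩ := hi
    rw [h3] at h1 h2
    have hdR : (distR a b w₀ m i : ℝ) = R₀ - i * (m - 1 : ℝ) := by
      have := (distW_spec hm hw hiN).2.1
      have h' : ((distR a b w₀ m i : ℤ) : ℝ) = ((b - faceJ a w₀ m i - m : ℤ) : ℝ) := by rw [this]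
      push_cast at h'
      rw [h', faceJ]; push_cast; ring
    rw [hdR] at h1 h2
    constructor
    · rw [div_le_iff₀ hm1]; linarith
    · rw [show (R₀ - u - len) / (m - 1 : ℝ) + (len / (m - 1 : ℝ) + 1) = (R₀ - u + (m - 1 : ℝ)) / (m - 1 : ℝ) by
        field_simp; ring, lt_div_iff₀ hm1]; nlinarith
  calc (F.card : ℝ) ≤ ((FL ∪ FR).card : ℝ) := by exact_mod_cast Finset.card_le_card hcover
    _ ≤ (FL.card : ℝ) + FR.card := by exact_mod_cast Finset.card_union_le _ _
    _ ≤ 2 * ((⌊len / (m - 1 : ℝ)⌋₊ : ℝ) + 1) + 1 := by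
        have h1 : (FL.card : ℝ) ≤ (⌊len / (m - 1 : ℝ)⌋₊ : ℝ) + 1 := by exact_mod_cast hLcard
        have h2 : (FR.card : ℝ) ≤ (⌊len / (m - 1 : ℝ) + 1⌋₊ : ℝ) + 1 := by exact_mod_cast hRcard
        have h3 : (⌊len / (m - 1 : ℝ) + 1⌋₊ : ℝ) = (⌊len / (m - 1 : ℝ)⌋₊ : ℝ) + 1 := by
          rw [Nat.floor_add_one (div_nonneg hlen hm1.le)]; push_cast; ring
        linarith
    _ ≤ 2 * (len / (m - 1 : ℝ) + 2) := by
        have := Nat.floor_le (div_nonneg hlen hm1.le)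
        linarith

/-- **The dyadic level count**: at most `B₀ 2^k` windows at level `k`, `B₀ = 2 (c/(m-1) + 2)`, when all
distances are `≥ c`. [folklore] -/
theorem card_level_le {a b : ℤ} {w₀ m : ℕ} (hm : 2 ≤ m) (hw : m ≤ w₀) {c : ℝ} (hc : 0 < c)
    (hct : ∀ i < faceN a b w₀ m, c ≤ (distW a b w₀ m i : ℝ)) (k : ℕ) :
    (((Finset.range (faceN a b w₀ m)).filter fun i => DyadicLevel.level c (distW a b w₀ m i) = k).card : ℝ) ≤
      2 * (c / (m - 1 : ℝ) + 2) * (2 : ℝ) ^ k := by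
  classical
  have hsub : ((Finset.range (faceN a b w₀ m)).filter fun i => DyadicLevel.level c (distW a b w₀ m i) = k) ⊆
      (Finset.range (faceN a b w₀ m)).filter fun i =>
        (2 : ℝ) ^ k * c ≤ (distW a b w₀ m i : ℝ) ∧ (distW a b w₀ m i : ℝ) < (2 : ℝ) ^ k * c + (2 : ℝ) ^ k * c := by
    intro i hi
    rw [Finset.mem_filter] at hi ⊢
    have hiN := Finset.mem_range.1 hi.1
    refine ⟨hi.1, ?_, ?_⟩
    · have := DyadicLevel.pow_level_le hc (hct i hiN)
      rw [hi.2] at this; exact this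
    · have := DyadicLevel.lt_pow_level_succ hc (t := (distW a b w₀ m i : ℝ))
      rw [hi.2, pow_succ] at this; linarith
  have hm1 : (0 : ℝ) < (m - 1 : ℝ) := by
    have : (2 : ℝ) ≤ m := by exact_mod_cast hm
    linarith
  calc (((Finset.range (faceN a b w₀ m)).filter fun i => DyadicLevel.level c (distW a b w₀ m i) = k).card : ℝ)
      ≤ (((Finset.range (faceN a b w₀ m)).filter fun i =>
          (2 : ℝ) ^ k * c ≤ (distW a b w₀ m i : ℝ) ∧ (distW a b w₀ m i : ℝ) < (2 : ℝ) ^ k * c + (2 : ℝ) ^ k * c).card : ℝ) := by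
        exact_mod_cast Finset.card_le_card hsub
    _ ≤ 2 * ((2 : ℝ) ^ k * c / (m - 1 : ℝ) + 2) := card_distW_window_le hm hw (by positivity)
    _ ≤ 2 * (c / (m - 1 : ℝ) + 2) * (2 : ℝ) ^ k := by
        have h2k : (1 : ℝ) ≤ (2 : ℝ) ^ k := one_le_pow₀ (by norm_num)
        have h0 : 0 ≤ c / (m - 1 : ℝ) := by positivity
        rw [show (2 : ℝ) ^ k * c / (m - 1 : ℝ) = (2 : ℝ) ^ k * (c / (m - 1 : ℝ)) by ring]
        nlinarith

/-! ### The bad event of a face -/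

/-- `i + 2 ≤ 2^{i+1}`. [folklore] -/
theorem add_two_le_two_pow_succ (i : ℕ) : (i : ℝ) + 2 ≤ (2 : ℝ) ^ (i + 1) := by
  induction i with
  | zero => norm_num
  | succ n ih => push_cast; rw [pow_succ]; linarith

set_option maxHeartbeats 1600000 in
/-- **The bad event of a wall face is small**: with corner width `w₀ = 10 K m`, if every window
fitting in `[a, b]` is clean and the far sites are at distance `≥ S ≥ 24 K m` from every face column,
`P(badFace a b w₀ m) ≤ C (m/S)^ε`. [cite: SchrammSmirnov2011, §4, proof of Prop. 4.1 (the small-bay event has small probability)] -/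
theorem real_badFace_le : ∃ C ε : ℝ, ∃ K m₀ : ℕ, 0 < C ∧ 0 < ε ∧ 1 ≤ K ∧
    ∀ (𝒞 : CollarDatum) (ψ : LatticeSym) (a b : ℤ) (m : ℕ) (S : ℝ), a ≤ b → m₀ ≤ m → (24 * K * m : ℝ) ≤ S →
      (∀ (j : ℤ) (R₁ : ℕ), a ≤ j - R₁ - 2 → j + m + R₁ + 2 ≤ b → (𝒞.map ψ).CleanWindow j m R₁) →
      (∀ u ∈ 𝒞.Far, ∀ x : ℤ, a ≤ x → x ≤ b → S ≤ dist (meshPoint 1 (ψ.σ u)) (meshPoint 1 ![x, 0])) →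
      (bondPercolation (zdGraph 2) half).real (𝒞.badFace ψ a b (10 * K * m) m) ≤ C * ((m : ℝ) / S) ^ ε := by
  obtain ⟨A, α, ε, K, m₀, hA, hε, hεα, hK, hwin⟩ := window_cost
  obtain ⟨αc, c₀, hαc, hc₀, hcorner⟩ := real_cornerEvent_le
  obtain ⟨ε', hε'⟩ : ∃ ε' : ℝ, ε' = min ε αc := ⟨_, rfl⟩
  have hε'pos : 0 < ε' := by rw [hε']; exact lt_min hε hαc
  have hε'ε : ε' ≤ ε := by rw [hε']; exact min_le_left _ _
  have hε'c : ε' ≤ αc := by rw [hε']; exact min_le_right _ _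
  -- the constants
  obtain ⟨B₀, hB₀⟩ : ∃ B₀ : ℝ, B₀ = 2 * (20 * K + 2) := ⟨_, rfl⟩
  have hB₀0 : 0 ≤ B₀ := by rw [hB₀]; positivity
  obtain ⟨q, hq⟩ : ∃ q : ℝ, q = 1 - (2 : ℝ) ^ (-(α - ε)) := ⟨_, rfl⟩
  have hq0 : 0 < q := by
    have : (2 : ℝ) ^ (-(α - ε)) < 1 := Real.rpow_lt_one_of_one_lt_of_neg (by norm_num) (by linarith)
    rw [hq]; linarith
  obtain ⟨C, hC⟩ : ∃ C : ℝ, C = 2 * (12 * K : ℝ) ^ ε' + B₀ * A * (400 * K : ℝ) ^ ε / q := ⟨_, rfl⟩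
  have hC0 : 0 < C := by
    rw [hC]; exact add_pos_of_pos_of_nonneg (by positivity) (div_nonneg (by positivity) hq0.le)
  refine ⟨C, ε', K, max (max m₀ 4) ⌈c₀⌉₊, hC0, hε'pos, hK, fun 𝒞 ψ a b m S hab hm hS hclean hfar => ?_⟩
  have hm₀ : m₀ ≤ m := le_trans (le_trans (le_max_left _ _) (le_max_left _ _)) hm
  have hm4 : 4 ≤ m := le_trans (le_trans (le_max_right _ _) (le_max_left _ _)) hm
  have hmc₀ : c₀ ≤ m := (Nat.le_ceil c₀).trans (by exact_mod_cast le_trans (le_max_right _ _) hm)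
  generalize hw₀ : 10 * K * m = w₀
  have hKm : m ≤ K * m := Nat.le_mul_of_pos_left m (by omega)
  have hw₀m : m ≤ w₀ := by
    rw [← hw₀, show 10 * K * m = 10 * (K * m) by ring]
    generalize K * m = KM at hKm ⊢; omega
  have hw₀R : (w₀ : ℝ) = 10 * K * m := by rw [← hw₀]; push_cast; ring
  have hmR : (4 : ℝ) ≤ m := by exact_mod_cast hm4
  have hKR : (1 : ℝ) ≤ K := by exact_mod_cast hK
  have hKmR : (m : ℝ) ≤ K * m := by exact_mod_cast hKm
  have hS0 : 0 < S := by nlinarith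
  have hmS : (m : ℝ) / S ≤ 1 := by rw [div_le_one hS0]; nlinarith
  have hmS0 : 0 ≤ (m : ℝ) / S := by positivity
  -- the corner terms
  have hcornerA : ∀ c : ℤ, a ≤ c → c ≤ b → (bondPercolation (zdGraph 2) half).real (𝒞.cornerEvent ψ c w₀) ≤ (12 * K : ℝ) ^ ε' * ((m : ℝ) / S) ^ ε' := by
    intro c hac hcb
    have h1 : c₀ ≤ (w₀ : ℝ) + 2 := by
      have : (m : ℝ) ≤ w₀ := by exact_mod_cast hw₀m
      linarith
    have h2 : 2 * ((w₀ : ℝ) + 2) ≤ S := by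
      rw [hw₀R]; nlinarith
    have key := hcorner 𝒞 ψ c w₀ S h1 h2 fun u hu => hfar u hu c hac hcb
    have hbase : ((w₀ : ℝ) + 2) / S ≤ 12 * K * ((m : ℝ) / S) := by
      rw [mul_div_assoc', div_le_div_iff_of_pos_right hS0, hw₀R]
      nlinarith
    have hbase1 : ((w₀ : ℝ) + 2) / S ≤ 1 := by rw [div_le_one hS0]; linarith
    calc (bondPercolation (zdGraph 2) half).real (𝒞.cornerEvent ψ c w₀) ≤ (((w₀ : ℝ) + 2) / S) ^ αc := key
      _ ≤ (((w₀ : ℝ) + 2) / S) ^ ε' := Real.rpow_le_rpow_of_exponent_ge' (by positivity) hbase1 hε'pos.le hε'c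
      _ ≤ (12 * K * ((m : ℝ) / S)) ^ ε' := Real.rpow_le_rpow (by positivity) hbase hε'pos.le
      _ = (12 * K : ℝ) ^ ε' * ((m : ℝ) / S) ^ ε' := Real.mul_rpow (by positivity) hmS0
  -- the window terms
  obtain ⟨c, hc⟩ : ∃ c : ℝ, c = (w₀ : ℝ) + 1 - m := ⟨_, rfl⟩
  have hc9 : 9 * K * m ≤ c := by
    rw [hc, hw₀R]; nlinarith
  have hc0 : 0 < c := by nlinarith
  have hmc : (m : ℝ) ≤ c := by nlinarith
  have hm1c : (m : ℝ) - 1 ≤ c := by linarith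
  have hc10 : c ≤ 10 * K * m := by
    rw [hc, hw₀R]; linarith
  have hm2 : 2 ≤ m := by omega
  have hct : ∀ i < faceN a b w₀ m, c ≤ (distW a b w₀ m i : ℝ) := by
    intro i hi
    have := (distW_spec hm2 hw₀m hi).2.2.1
    have h' : ((w₀ : ℤ) + 1 - m : ℝ) ≤ ((distW a b w₀ m i : ℤ) : ℝ) := by exact_mod_cast this
    push_cast at h'
    rw [hc]; exact h'
  have hgrow : ∀ i < faceN a b w₀ m, (distW a b w₀ m i : ℝ) < (2 : ℝ) ^ (i + 1) * c := by
    intro i _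
    have h1 : (distW a b w₀ m i : ℝ) ≤ distL w₀ m i := by exact_mod_cast min_le_left _ _
    have h2 : (distL w₀ m i : ℝ) = (w₀ : ℝ) - 1 + i * ((m : ℝ) - 1) := by
      rw [distL]; push_cast [Nat.cast_sub (by omega : 1 ≤ w₀), Nat.cast_sub (by omega : 1 ≤ m)]; ring
    have h3 := add_two_le_two_pow_succ i
    have hi0 : (0 : ℝ) ≤ i := by positivity
    have h4 : (i : ℝ) * ((m : ℝ) - 1) ≤ i * c := mul_le_mul_of_nonneg_left hm1c hi0
    calc (distW a b w₀ m i : ℝ) ≤ (w₀ : ℝ) - 1 + i * ((m : ℝ) - 1) := by rw [← h2]; exact h1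
      _ < c + (i + 1) * c := by
          have e : (w₀ : ℝ) - 1 = c + m - 2 := by rw [hc]; ring
          rw [e]; linarith
      _ = (i + 2) * c := by ring
      _ ≤ (2 : ℝ) ^ (i + 1) * c := mul_le_mul_of_nonneg_right h3 hc0.le
  have hcount : ∀ k, (((Finset.range (faceN a b w₀ m)).filter fun i => DyadicLevel.level c (distW a b w₀ m i) = k).card : ℝ) ≤
      B₀ * (2 : ℝ) ^ k := by
    intro k
    refine (card_level_le hm2 hw₀m hc0 hct k).trans ?_
    have hm1 : (0 : ℝ) < (m : ℝ) - 1 := by linarith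
    have : c / ((m : ℝ) - 1) ≤ 20 * K := by
      rw [div_le_iff₀ hm1]; nlinarith
    have h2k : (0 : ℝ) ≤ (2 : ℝ) ^ k := by positivity
    rw [hB₀]
    exact mul_le_mul_of_nonneg_right (by linarith) h2k
  -- the per-window cost in level form
  obtain ⟨w, hw⟩ : ∃ w : ℝ, w = 40 * c := ⟨_, rfl⟩
  have hw0 : 0 ≤ w := by rw [hw]; positivity
  have hp : ∀ i < faceN a b w₀ m,
      (bondPercolation (zdGraph 2) half).real (𝒞.patternOneAt ψ (faceJ a w₀ m i) m ∪ 𝒞.patternTwoAt ψ (faceJ a w₀ m i) m) ≤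
        A * (((2 : ℝ) ^ DyadicLevel.level c (distW a b w₀ m i))⁻¹ ^ (1 + α) *
          ((2 : ℝ) ^ DyadicLevel.level c (distW a b w₀ m i) * w / S) ^ ε) := by
    intro i hi
    obtain ⟨hdL, hdR, hlow, hleft, hright⟩ := distW_spec hm2 hw₀m hi
    set t : ℕ := distW a b w₀ m i with ht
    set k : ℕ := DyadicLevel.level c (t : ℝ) with hk
    have htc : c ≤ (t : ℝ) := hct i hi
    have ht8 : 8 * K * m ≤ t := by
      have : ((8 * K * m : ℕ) : ℝ) ≤ (t : ℝ) := by push_cast; linarith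
      exact_mod_cast this
    have htm : m + 3 ≤ t := by
      have h8 : 8 * (K * m) ≤ t := by simpa [mul_assoc] using ht8
      generalize K * m = KM at h8 hKm; omega
    set d : ℕ := t - m - 3 with hd
    have hdt : d + m + 3 = t := by omega
    -- the window is clean with radius `t - 2`
    have hW : (𝒞.map ψ).CleanWindow (faceJ a w₀ m i) m (d + m + 1) := by
      refine hclean _ _ ?_ ?_
      · have : ((d + m + 1 : ℕ) : ℤ) = (t : ℤ) - 2 := by push_cast; omega
        rw [this]; linarith
      · have : ((d + m + 1 : ℕ) : ℤ) = (t : ℤ) - 2 := by push_cast; omega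
        rw [this]; linarith
    have hfarj : ∀ u ∈ 𝒞.Far, S ≤ dist (meshPoint 1 (ψ.σ u)) (meshPoint 1 ![faceJ a w₀ m i, 0]) := fun u hu =>
      hfar u hu _ (by have : (0:ℤ) ≤ t := by positivity
                      linarith) (by have : (0:ℤ) ≤ t := by positivity
                                    linarith)
    -- level bounds
    have hk1 : (2 : ℝ) ^ k * c ≤ t := DyadicLevel.pow_level_le hc0 htc
    have hk2 : (t : ℝ) < (2 : ℝ) ^ (k + 1) * c := DyadicLevel.lt_pow_level_succ hc0
    have h2k : (0 : ℝ) < (2 : ℝ) ^ k := by positivity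
    have ht0 : (0 : ℝ) < t := by linarith [mul_pos h2k hc0]
    -- `(m/t)^{1+α} ≤ (2^k)⁻¹^{1+α}`
    have hbase : (m : ℝ) / t ≤ ((2 : ℝ) ^ k)⁻¹ := by
      have : (m : ℝ) * (2 : ℝ) ^ k ≤ (2 : ℝ) ^ k * c := by
        rw [mul_comm]; exact mul_le_mul_of_nonneg_left hmc h2k.le
      rw [inv_eq_one_div, div_le_div_iff₀ ht0 h2k, one_mul]
      linarith
    have hpow : ((m : ℝ) / t) ^ (1 + α) ≤ (((2 : ℝ) ^ k)⁻¹) ^ (1 + α) :=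
      Real.rpow_le_rpow (div_nonneg (Nat.cast_nonneg m) ht0.le) hbase (add_nonneg zero_le_one (hε.le.trans hεα.le))
    -- the one-arm factor in level form
    have h2kc : 0 < (2 : ℝ) ^ k * c := mul_pos h2k hc0
    have hk2' : (t : ℝ) < 2 * ((2 : ℝ) ^ k * c) := by rw [pow_succ] at hk2; linarith only [hk2]
    have hwS : 0 ≤ (2 : ℝ) ^ k * w / S := div_nonneg (mul_nonneg h2k.le hw0) hS0.le
    have hfac1 : (5 * (t : ℝ) / S) ^ ε ≤ ((2 : ℝ) ^ k * w / S) ^ ε := by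
      refine Real.rpow_le_rpow (div_nonneg (by linarith only [ht0]) hS0.le) ?_ hε.le
      rw [div_le_div_iff_of_pos_right hS0, hw]
      linarith only [hk2', h2kc]
    have hfac2 : S < 10 * (t : ℝ) → (1 : ℝ) ≤ ((2 : ℝ) ^ k * w / S) ^ ε := fun hcase => by
      refine Real.one_le_rpow ?_ hε.le
      rw [le_div_iff₀ hS0, one_mul, hw]
      linarith only [hk2', h2kc, hcase]
    -- the window cost
    obtain ⟨hnear, hfarb⟩ := hwin 𝒞 ψ (faceJ a w₀ m i) m d S hm₀ (by rw [hdt]; exact ht8) hW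
    rw [hdt] at hnear hfarb
    have hx' : 0 ≤ (((2 : ℝ) ^ k)⁻¹) ^ (1 + α) := Real.rpow_nonneg (inv_nonneg.2 h2k.le) _
    have hy' : 0 ≤ ((2 : ℝ) ^ k * w / S) ^ ε := Real.rpow_nonneg hwS _
    have hAx : A * ((m : ℝ) / t) ^ (1 + α) ≤ A * (((2 : ℝ) ^ k)⁻¹) ^ (1 + α) := mul_le_mul_of_nonneg_left hpow hA.le
    have hAx0 : 0 ≤ A * (((2 : ℝ) ^ k)⁻¹) ^ (1 + α) := mul_nonneg hA.le hx'
    by_cases hcase : 10 * (t : ℝ) ≤ S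
    · have h1 := hfarb hcase hfarj
      calc (bondPercolation (zdGraph 2) half).real (𝒞.patternOneAt ψ (faceJ a w₀ m i) m ∪ 𝒞.patternTwoAt ψ (faceJ a w₀ m i) m)
          ≤ A * ((m : ℝ) / t) ^ (1 + α) * (5 * (t : ℝ) / S) ^ ε := h1
        _ ≤ A * (((2 : ℝ) ^ k)⁻¹ ^ (1 + α)) * ((2 : ℝ) ^ k * w / S) ^ ε :=
            mul_le_mul hAx hfac1 (Real.rpow_nonneg (div_nonneg (by linarith only [ht0]) hS0.le) _) hAx0
        _ = A * ((((2 : ℝ) ^ k)⁻¹ ^ (1 + α)) * ((2 : ℝ) ^ k * w / S) ^ ε) := by ring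
    · push Not at hcase
      have hfac := hfac2 hcase
      calc (bondPercolation (zdGraph 2) half).real (𝒞.patternOneAt ψ (faceJ a w₀ m i) m ∪ 𝒞.patternTwoAt ψ (faceJ a w₀ m i) m)
          ≤ A * ((m : ℝ) / t) ^ (1 + α) := hnear
        _ ≤ A * (((2 : ℝ) ^ k)⁻¹ ^ (1 + α)) * 1 := by rw [mul_one]; exact hAx
        _ ≤ A * (((2 : ℝ) ^ k)⁻¹ ^ (1 + α)) * ((2 : ℝ) ^ k * w / S) ^ ε := mul_le_mul_of_nonneg_left hfac hAx0
        _ = A * ((((2 : ℝ) ^ k)⁻¹ ^ (1 + α)) * ((2 : ℝ) ^ k * w / S) ^ ε) := by ring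
  have hsum := DyadicLevel.sum_le_of_levels (p := fun i => (bondPercolation (zdGraph 2) half).real (𝒞.patternOneAt ψ (faceJ a w₀ m i) m ∪ 𝒞.patternTwoAt ψ (faceJ a w₀ m i) m))
    (t := fun i => (distW a b w₀ m i : ℝ)) hεα hc0 hw0 hS0 hA.le hB₀0
    (faceN a b w₀ m) hct hgrow hcount hp
  -- `(w/S)^ε ≤ (400 K)^ε (m/S)^ε'`
  have hwS : (w / S) ^ ε ≤ (400 * K : ℝ) ^ ε * ((m : ℝ) / S) ^ ε' := by
    have h1 : w / S ≤ 400 * K * ((m : ℝ) / S) := by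
      rw [mul_div_assoc', div_le_div_iff_of_pos_right hS0, hw]; nlinarith
    calc (w / S) ^ ε ≤ (400 * K * ((m : ℝ) / S)) ^ ε := Real.rpow_le_rpow (by positivity) h1 hε.le
      _ = (400 * K : ℝ) ^ ε * ((m : ℝ) / S) ^ ε := Real.mul_rpow (by positivity) hmS0
      _ ≤ (400 * K : ℝ) ^ ε * ((m : ℝ) / S) ^ ε' :=
          mul_le_mul_of_nonneg_left (Real.rpow_le_rpow_of_exponent_ge' hmS0 hmS hε'pos.le hε'ε) (by positivity)
  -- assemble
  have hca := hcornerA a le_rfl hab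
  have hcb := hcornerA b hab le_rfl
  have hsum' : ∑ i ∈ Finset.range (faceN a b w₀ m),
      (bondPercolation (zdGraph 2) half).real (𝒞.patternOneAt ψ (faceJ a w₀ m i) m ∪ 𝒞.patternTwoAt ψ (faceJ a w₀ m i) m) ≤
        B₀ * A * ((400 * K : ℝ) ^ ε * ((m : ℝ) / S) ^ ε') / q := by
    refine hsum.trans ?_
    rw [← hq]
    exact div_le_div_of_nonneg_right (mul_le_mul_of_nonneg_left hwS (by positivity)) hq0.le
  calc (bondPercolation (zdGraph 2) half).real (𝒞.badFace ψ a b w₀ m)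
      ≤ (bondPercolation (zdGraph 2) half).real (𝒞.cornerEvent ψ a w₀) + (bondPercolation (zdGraph 2) half).real (𝒞.cornerEvent ψ b w₀) +
          ∑ i ∈ Finset.range (faceN a b w₀ m),
            (bondPercolation (zdGraph 2) half).real (𝒞.patternOneAt ψ (faceJ a w₀ m i) m ∪ 𝒞.patternTwoAt ψ (faceJ a w₀ m i) m) :=
        real_badFace_le_sum a b w₀ m
    _ ≤ (12 * K : ℝ) ^ ε' * ((m : ℝ) / S) ^ ε' + (12 * K : ℝ) ^ ε' * ((m : ℝ) / S) ^ ε' +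
          B₀ * A * ((400 * K : ℝ) ^ ε * ((m : ℝ) / S) ^ ε') / q := by linarith
    _ = C * ((m : ℝ) / S) ^ ε' := by rw [hC]; ring

end CollarDatum

end Seeded

end Literature.Probability.Percolation

end
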